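import Summits.NavierStokesRegularity.NavierStokesRegularity.Theorems.ExtremiserTransienceNearExtremalTransienceExtremiserLiouvilleDensities
import HarnessLib

/-!
# Crux `ExtremiserTransience.NearExtremalTransience` (stmt-NavierStokesRegularity-21883), line `extremiser_liouville`,
# stub K1b — «NO GAIN FROM CONSTANTS», file 4/5: THE `N³`-ARRAY OF TRANSLATES INSIDE THE CARRIER'S PLATEAU

`--supports stmt-NavierStokesRegularity-21883` (helper).  Author: prover seat `ns-el-k1b` (g0).

For `u` with `tsupport u ⊆ B̄_R` (`R ≥ 0`), spacing `s > 2R` and plateau radius `L > 2sN + R`, the TEST FIELD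
`v_N = Σ_{k ∈ [N]³} u(· − s·k) + Φ_{b,L}` (`testField u b s N L`) is `C^∞`, compactly supported, divergence free, and:
* GERMS (`testField_eventuallyEq_active` / `_inactive`): near a point of the `k`-th copy's support `v_N = u(· − s k) + b`
  (the other copies vanish nearby by the spacing, the carrier is `≡ b` on the plateau); elsewhere `v_N = Φ_{b,L}` nearby;
* hence the densities are ADDITIVE over the pieces (`densities_testField`), `‖v_N‖ ≤ M` whenever `‖u + b‖ ≤ M` and
  `‖b‖ ≤ M` (`norm_testField_le`), and
* `S(v_N) = N³S(u) + S(Φ_b)`, `Z(v_N) = N³Z(u) + L·Z(Φ_b)`, `P(v_N) = N³P(u) + P(Φ_b)/L` (`integrals_testField`;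
  translation invariance of Lebesgue measure and the carrier scalings of file 2/5).

WHAT THIS IS NOT: bookkeeping for file 5/5; K1b is a STATIC statement about analytic κ⋆-efficient fields; the crux NET, rung N0 and NS regularity stay OPEN — nothing here proves NS regularity. [folklore]
-/

noncomputable section

open Set Filter Topology MeasureTheory Metric
open scoped InnerProductSpace RealInnerProductSpace ENNReal NNReal ContDiff
open Literature.Analysis.FluidPDE

namespace Summit.NavierStokesRegularity.NavierStokesRegularity.Theorems

-- the problem directory repeats the summit name (`NavierStokesRegularity/NavierStokesRegularity`)
set_option linter.dupNamespace false

namespace ExtremiserLiouville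

open DepletionLadder.KStar.HalfSpace (E3)

/-! ## The test fields: an `N³`-array of translates inside the plateau of the carrier -/

/-- **The array** `A(x) = Σ_k u(x − c_k)`. -/
def arrayField (u : E3 → E3) (s : ℝ) (N : ℕ) (x : E3) : E3 :=
  ∑ k : Fin N × Fin N × Fin N, u (x - centre s k)

/-- **The test field** `v_N = Σ_k u(· − c_k) + Φ_{b,L}`. -/
def testField (u : E3 → E3) (b : E3) (s : ℝ) (N : ℕ) (L : ℝ) (x : E3) : E3 :=
  arrayField u s N x + carrierAt b L x

section TestField

variable (u : E3 → E3) (b : E3) {R s L : ℝ} {N : ℕ}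

/-! Geometry hypotheses used below: `tsupport u ⊆ B̄_R` (`R ≥ 0`), spacing `s > 2R`, plateau radius `L > 2sN + R`. -/

/-- Auxiliary (`spacing_nonneg`). [folklore] -/
theorem spacing_nonneg (hR0 : 0 ≤ R) (hs : 2 * R < s) : 0 ≤ s := by linarith

/-- Auxiliary (`plateau_pos`). [folklore] -/
theorem plateau_pos (hR0 : 0 ≤ R) (hs : 2 * R < s) (hL : 2 * s * N + R < L) : 0 < L := by
  have := spacing_nonneg hR0 hs
  nlinarith [Nat.cast_nonneg (α := ℝ) N]

variable {u}

/-- Uniqueness of the active copy. [folklore] -/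
theorem eq_of_mem_tsupport (hR0 : 0 ≤ R) (hsupp : tsupport u ⊆ closedBall (0 : E3) R) (hs : 2 * R < s)
    {x : E3} {k j : Fin N × Fin N × Fin N}
    (hk : x - centre s k ∈ tsupport u) (hj : x - centre s j ∈ tsupport u) : k = j := by
  by_contra h
  have h1 := le_norm_centre_sub (spacing_nonneg hR0 hs) h
  have hk' := hsupp hk
  have hj' := hsupp hj
  rw [mem_closedBall, dist_zero_right] at hk' hj'
  have : ‖centre s k - centre s j‖ ≤ R + R := by
    calc ‖centre s k - centre s j‖ = ‖(x - centre s j) - (x - centre s k)‖ := by congr 1; abel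
      _ ≤ ‖x - centre s j‖ + ‖x - centre s k‖ := norm_sub_le _ _
      _ ≤ R + R := add_le_add hj' hk'
  linarith

/-- An active point lies in the plateau ball. [folklore] -/
theorem norm_lt_of_mem_tsupport (hR0 : 0 ≤ R) (hsupp : tsupport u ⊆ closedBall (0 : E3) R) (hs : 2 * R < s)
    (hL : 2 * s * N + R < L) {x : E3} {k : Fin N × Fin N × Fin N}
    (hk : x - centre s k ∈ tsupport u) : ‖x‖ < L := by
  have hk' := hsupp hk
  rw [mem_closedBall, dist_zero_right] at hk'
  have hc := norm_centre_le (spacing_nonneg hR0 hs) k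
  calc ‖x‖ = ‖(x - centre s k) + centre s k‖ := by rw [sub_add_cancel]
    _ ≤ ‖x - centre s k‖ + ‖centre s k‖ := norm_add_le _ _
    _ ≤ R + 2 * s * N := add_le_add hk' hc
    _ < L := by linarith

/-- **Germ at an active point:** `v_N = u(· − c_k) + b` near `x`. [folklore] -/
theorem testField_eventuallyEq_active (hR0 : 0 ≤ R) (hsupp : tsupport u ⊆ closedBall (0 : E3) R)
    (hs : 2 * R < s) (hL : 2 * s * N + R < L) {x : E3} {k : Fin N × Fin N × Fin N}
    (hk : x - centre s k ∈ tsupport u) :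
    testField u b s N L =ᶠ[𝓝 x] fun y => u (y - centre s k) + b := by
  have hall : ∀ᶠ y in 𝓝 x, ∀ j ∈ (Finset.univ.erase k), u (y - centre s j) = 0 := by
    rw [Filter.eventually_all_finset]
    intro j hj
    exact translate_eventuallyEq_zero u fun hj' => (Finset.ne_of_mem_erase hj) (eq_of_mem_tsupport hR0 hsupp hs hj' hk)
  have h2 : carrierAt b L =ᶠ[𝓝 x] fun _ => b :=
    carrierAt_eventuallyEq b (plateau_pos hR0 hs hL) (norm_lt_of_mem_tsupport hR0 hsupp hs hL hk)
  filter_upwards [hall, h2] with y hy hy2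
  unfold testField arrayField
  rw [← Finset.add_sum_erase _ _ (Finset.mem_univ k), Finset.sum_eq_zero hy, add_zero, hy2]

/-- **Germ at an inactive point:** `v_N = Φ_{b,L}` near `x`. [folklore] -/
theorem testField_eventuallyEq_inactive {x : E3}
    (hx : ∀ k : Fin N × Fin N × Fin N, x - centre s k ∉ tsupport u) :
    testField u b s N L =ᶠ[𝓝 x] carrierAt b L := by
  have hall : ∀ᶠ y in 𝓝 x, ∀ j ∈ (Finset.univ : Finset (Fin N × Fin N × Fin N)), u (y - centre s j) = 0 := by
    rw [Filter.eventually_all_finset]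
    intro j _
    exact translate_eventuallyEq_zero u (hx j)
  filter_upwards [hall] with y hy
  unfold testField arrayField
  rw [Finset.sum_eq_zero hy, zero_add]

/-- **Additivity of the densities:** `ρ(v_N)(x) = Σ_k ρ(u)(x − c_k) + ρ(Φ_{b,L})(x)` for `ρ ∈ {σ, ζ, π}`. [folklore] -/
theorem densities_testField (hR0 : 0 ≤ R) (hsupp : tsupport u ⊆ closedBall (0 : E3) R)
    (hs : 2 * R < s) (hL : 2 * s * N + R < L) (x : E3) :
    sig (testField u b s N L) x = (∑ k : Fin N × Fin N × Fin N, sig u (x - centre s k)) + sig (carrierAt b L) x ∧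
    zet (testField u b s N L) x = (∑ k : Fin N × Fin N × Fin N, zet u (x - centre s k)) + zet (carrierAt b L) x ∧
    pal (testField u b s N L) x = (∑ k : Fin N × Fin N × Fin N, pal u (x - centre s k)) + pal (carrierAt b L) x := by
  by_cases hex : ∃ k : Fin N × Fin N × Fin N, x - centre s k ∈ tsupport u
  · obtain ⟨k, hk⟩ := hex
    have hger := testField_eventuallyEq_active b hR0 hsupp hs hL hk
    have hcar := carrierAt_eventuallyEq b (plateau_pos hR0 hs hL) (norm_lt_of_mem_tsupport hR0 hsupp hs hL hk)
    obtain ⟨t1, t2, t3⟩ := densities_translate u (centre s k) b x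
    obtain ⟨c1, c2, c3⟩ := densities_const b x
    have hoth : ∀ j ∈ (Finset.univ : Finset (Fin N × Fin N × Fin N)), j ≠ k → x - centre s j ∉ tsupport u :=
      fun j _ hj hj' => hj (eq_of_mem_tsupport hR0 hsupp hs hj' hk)
    refine ⟨?_, ?_, ?_⟩
    · rw [sig_congr hger, t1, sig_congr hcar, c1, add_zero,
        Finset.sum_eq_single k (fun j hj hjk => (densities_eq_zero_of_notMem (hoth j hj hjk)).1)
          (fun h => absurd (Finset.mem_univ k) h)]
    · rw [zet_congr hger, t2, zet_congr hcar, c2, add_zero,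
        Finset.sum_eq_single k (fun j hj hjk => (densities_eq_zero_of_notMem (hoth j hj hjk)).2.1)
          (fun h => absurd (Finset.mem_univ k) h)]
    · rw [pal_congr hger, t3, pal_congr hcar, c3, add_zero,
        Finset.sum_eq_single k (fun j hj hjk => (densities_eq_zero_of_notMem (hoth j hj hjk)).2.2)
          (fun h => absurd (Finset.mem_univ k) h)]
  · have hx : ∀ k : Fin N × Fin N × Fin N, x - centre s k ∉ tsupport u := fun k hk => hex ⟨k, hk⟩
    have hger := testField_eventuallyEq_inactive b (L := L) hx
    refine ⟨?_, ?_, ?_⟩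
    · rw [sig_congr hger, Finset.sum_eq_zero fun j _ => (densities_eq_zero_of_notMem (hx j)).1, zero_add]
    · rw [zet_congr hger, Finset.sum_eq_zero fun j _ => (densities_eq_zero_of_notMem (hx j)).2.1, zero_add]
    · rw [pal_congr hger, Finset.sum_eq_zero fun j _ => (densities_eq_zero_of_notMem (hx j)).2.2, zero_add]

/-- **Sup bound:** `‖v_N‖ ≤ M` if `‖u + b‖ ≤ M` and `‖b‖ ≤ M`. [folklore] -/
theorem norm_testField_le (hR0 : 0 ≤ R) (hsupp : tsupport u ⊆ closedBall (0 : E3) R)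
    (hs : 2 * R < s) (hL : 2 * s * N + R < L) {M : ℝ} (hM : ∀ y, ‖u y + b‖ ≤ M) (hbM : ‖b‖ ≤ M)
    (x : E3) : ‖testField u b s N L x‖ ≤ M := by
  by_cases hex : ∃ k : Fin N × Fin N × Fin N, x - centre s k ∈ tsupport u
  · obtain ⟨k, hk⟩ := hex
    have h := (testField_eventuallyEq_active b hR0 hsupp hs hL hk).self_of_nhds
    rw [h]; exact hM _
  · have hx : ∀ k : Fin N × Fin N × Fin N, x - centre s k ∉ tsupport u := fun k hk => hex ⟨k, hk⟩
    have h := (testField_eventuallyEq_inactive b (L := L) hx).self_of_nhds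
    rw [h]; exact (norm_carrierAt_le b (plateau_pos hR0 hs hL) x).trans hbM

/-- `v_N` is `C^∞`. [folklore] -/
theorem contDiff_testField (hu : ContDiff ℝ ∞ u) (s : ℝ) (N : ℕ) (L : ℝ) : ContDiff ℝ ∞ (testField u b s N L) := by
  unfold testField arrayField
  exact (ContDiff.sum fun k _ => hu.comp (contDiff_id.sub contDiff_const)).add (contDiff_carrierAt b L)

/-- `v_N` is divergence free. [folklore] -/
theorem isDivFree_testField (hR0 : 0 ≤ R) (hsupp : tsupport u ⊆ closedBall (0 : E3) R)
    (hs : 2 * R < s) (hL : 2 * s * N + R < L) (hdiv : VectorCalculus.IsDivFree u) :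
    VectorCalculus.IsDivFree (testField u b s N L) := by
  intro x
  by_cases hex : ∃ k : Fin N × Fin N × Fin N, x - centre s k ∈ tsupport u
  · obtain ⟨k, hk⟩ := hex
    unfold VectorCalculus.divergence
    rw [(testField_eventuallyEq_active b hR0 hsupp hs hL hk).fderiv_eq, fderiv_translate_add_const]
    exact hdiv _
  · have hx : ∀ k : Fin N × Fin N × Fin N, x - centre s k ∉ tsupport u := fun k hk => hex ⟨k, hk⟩
    unfold VectorCalculus.divergence
    rw [(testField_eventuallyEq_inactive b (L := L) hx).fderiv_eq]
    exact isDivFree_carrierAt b L x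

/-- `v_N` vanishes off the ball of radius `L·R_K`, hence is compactly supported. [folklore] -/
theorem hasCompactSupport_testField (hR0 : 0 ≤ R) (hsupp : tsupport u ⊆ closedBall (0 : E3) R)
    (hs : 2 * R < s) (hL : 2 * s * N + R < L) : HasCompactSupport (testField u b s N L) := by
  refine HasCompactSupport.intro (isCompact_closedBall (0 : E3) (L * suppRad)) fun x hx => ?_
  rw [mem_closedBall, dist_zero_right, not_le] at hx
  have hLpos := plateau_pos hR0 hs hL
  have hL1 : L ≤ L * suppRad := le_mul_of_one_le_right hLpos.le one_le_suppRad
  have hnone : ∀ k : Fin N × Fin N × Fin N, x - centre s k ∉ tsupport u := by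
    intro k hk
    have := norm_lt_of_mem_tsupport hR0 hsupp hs hL hk
    linarith
  rw [(testField_eventuallyEq_inactive b (L := L) hnone).self_of_nhds]
  exact carrierAt_eq_zero b hLpos hx

/-- **The depletion data of `v_N`:** `S(v_N) = N³S(u) + S(Φ_b)`, `Z(v_N) = N³Z(u) + L·Z(Φ_b)`,
`P(v_N) = N³P(u) + P(Φ_b)/L`. [folklore] -/
theorem integrals_testField (hR0 : 0 ≤ R) (hsupp : tsupport u ⊆ closedBall (0 : E3) R)
    (hs : 2 * R < s) (hL : 2 * s * N + R < L) (hu : ContDiff ℝ ∞ u) (huc : HasCompactSupport u) :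
    (∫ x, sig (testField u b s N L) x) = (N : ℝ) ^ 3 * (∫ x, sig u x) + ∫ x, sig (carrier b) x ∧
    (∫ x, zet (testField u b s N L) x) = (N : ℝ) ^ 3 * (∫ x, zet u x) + L * ∫ x, zet (carrier b) x ∧
    (∫ x, pal (testField u b s N L) x) = (N : ℝ) ^ 3 * (∫ x, pal u x) + L⁻¹ * ∫ x, pal (carrier b) x := by
  have hLpos := plateau_pos hR0 hs hL
  obtain ⟨iu1, iu2, iu3⟩ := integrable_densities hu huc
  obtain ⟨ic1, ic2, ic3⟩ := integrable_densities (contDiff_carrierAt b L) (hasCompactSupport_carrierAt b hLpos)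
  have hcard : ((Finset.univ : Finset (Fin N × Fin N × Fin N)).card : ℝ) = (N : ℝ) ^ 3 := by
    rw [Finset.card_univ, Fintype.card_prod, Fintype.card_prod, Fintype.card_fin]; push_cast; ring
  have key : ∀ (ρ : (E3 → E3) → E3 → ℝ), Integrable (ρ u) (volume : Measure E3) →
      Integrable (ρ (carrierAt b L)) (volume : Measure E3) →
      (∀ x, ρ (testField u b s N L) x = (∑ k : Fin N × Fin N × Fin N, ρ u (x - centre s k)) + ρ (carrierAt b L) x) →
      (∫ x, ρ (testField u b s N L) x) = (N : ℝ) ^ 3 * (∫ x, ρ u x) + ∫ x, ρ (carrierAt b L) x := by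
    intro ρ hiu hic hpt
    have hik : ∀ k : Fin N × Fin N × Fin N, Integrable (fun x => ρ u (x - centre s k)) (volume : Measure E3) :=
      fun k => hiu.comp_sub_right _
    simp_rw [hpt]
    rw [integral_add (integrable_finsetSum _ fun k _ => hik k) hic, integral_finsetSum _ fun k _ => hik k]
    simp_rw [integral_sub_right_eq_self (fun x => ρ u x)]
    rw [Finset.sum_const, nsmul_eq_mul, hcard]
  refine ⟨?_, ?_, ?_⟩
  · rw [key sig iu1 ic1 fun x => (densities_testField b hR0 hsupp hs hL x).1]
    unfold sig; rw [stretching_carrierAt b hLpos]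
  · rw [key zet iu2 ic2 fun x => (densities_testField b hR0 hsupp hs hL x).2.1]
    unfold zet; rw [enstrophy_carrierAt b hLpos]
  · rw [key pal iu3 ic3 fun x => (densities_testField b hR0 hsupp hs hL x).2.2]
    unfold pal; rw [palinstrophy_carrierAt b hLpos]

end TestField

end ExtremiserLiouville

end Summit.NavierStokesRegularity.NavierStokesRegularity.Theorems

end
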